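import Summits.ResolutionOfSingularities.ResolutionOfSingularities.Theorems.WeightedInvariantDatumToEmbeddedInitialAtlas
import Summits.ResolutionOfSingularities.ResolutionOfSingularities.Theorems.WeightedInvariantHypersurfaceGenericPointOffSingImage
import Summits.ResolutionOfSingularities.ResolutionOfSingularities.Theorems.WeightedInvariantELadderOneStage
import Literature.AlgebraicGeometry.Resolution.NonPrincipalLocus
import Literature.AlgebraicGeometry.Resolution.AlterationsSectionDivisor
import HarnessLib

/-!
# e-ladder, rung `e = 1`: the START stage (`stub_e1_base` of the E1 skeleton)

Route `ResolutionOfSingularities/WeightedInvariant`, crux `Theses.WeightedInvariant.HypersurfaceCentreConstruction`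
(stmt-ResolutionOfSingularities-19897), door line `e-ladder`, rung `e = 1` (res-L1-w43-stub-10's E1 SKELETON
`D/res-D-pv-025/E1Skeleton.lean` sha16 ed471ca5092430d4). Registered stub `stub_e1_base` (M): a hypersurface pair
whose integral hypersurface `V(X)` is a CURVE (`dim V(X) = 1`) is a STAGE of torus rank `0` — ambient `Y`, the
hypersurface presented by its subscheme inclusion `ι : V(X) ⟶ Y`, trivial quotient `q = 𝟙`, the rank-`0` graded atlas
of `DatumToEmbedded.InitialAtlas.stub_initialAtlas` — satisfying the invariant `Stage.Inv` of the DEFS module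
`Theorems/WeightedInvariantELadderOneStage.lean`:

* (I1) at every maximal point `η` of the non-regular image `singImage (ker ι)` the ambient local ring `𝒪_{Y,η}` is
  regular of dimension `2`: `η = ι x` with `𝒪_{V(X),x}` non-regular, so `x` is not the generic point; in the
  `1`-dimensional integral `V(X)` this forces `coheight x = 1 = dim 𝒪_{V(X),x}` (`height + coheight ≤ dim`);
  `𝒪_{V(X),x} = 𝒪_{Y,η}/(g)` with `g ≠ 0` a local equation (`g = 0` would make `x` regular, `Y` being smooth over
  the field), and `dim 𝒪_{Y,η}/(g) + 1 = dim 𝒪_{Y,η}` (Stacks 00KW);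
* (I2) on every chart, the prime of `η` is homogeneous for the chart's `ℤ⁰`-grading (a grading by a one-point
  monoid has a single component, so EVERY ideal is homogeneous) and its quotient is graded-simple: `x`, hence
  `η`, is a CLOSED point (`height x = 0`), so on an affine chart its prime is maximal and the quotient is a field.

Helper lemmas are def-free; `--supports stmt-ResolutionOfSingularities-19897`. Nothing here is a claim about
Hironaka's problem or about resolution in positive characteristic; the rung is OURS (torus-equivariant embedded
resolution of curves) and its other stubs are conditional on the vendored facts F-AQS-T.
-/

noncomputable section

set_option linter.dupNamespace false -- mandated namespace of this single-conjunct summit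

open CategoryTheory AlgebraicGeometry TopologicalSpace IsLocalRing
open Literature.AlgebraicGeometry.Resolution
open Summit.ResolutionOfSingularities.ResolutionOfSingularities.Theorems

namespace Summit.ResolutionOfSingularities.ResolutionOfSingularities.Theorems.ELadderOne

/-! ## §1 Gradings by a one-point monoid of degrees -/

section OnePointGrading

variable {ι σ A : Type*} [DecidableEq ι] [AddMonoid ι] [Subsingleton ι] [CommRing A] [SetLike σ A]
  [AddSubmonoidClass σ A] (𝒜 : ι → σ) [GradedRing 𝒜]

/-- In a ring graded by a ONE-POINT monoid of degrees (the character group `ℤ⁰` of the trivial torus), the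
only homogeneous component of an element is the element itself. [folklore] -/
theorem decompose_apply_eq_self_of_subsingleton (r : A) (i : ι) : (DirectSum.decompose 𝒜 r i : A) = r := by
  classical
  conv_rhs => rw [← DirectSum.sum_support_decompose 𝒜 r]
  rw [Finset.sum_eq_single i (fun j _ hj => absurd (Subsingleton.elim j i) hj)
    (fun hi => by rw [DFinsupp.notMem_support_iff.mp hi, ZeroMemClass.coe_zero])]

/-- In a ring graded by a one-point monoid of degrees EVERY ideal is homogeneous. [folklore] -/
theorem isHomogeneous_of_subsingleton (I : Ideal A) : I.IsHomogeneous 𝒜 := by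
  intro i r hr
  rw [decompose_apply_eq_self_of_subsingleton 𝒜 r i]
  exact hr

end OnePointGrading

/-! ## §2 Points of a one-dimensional integral scheme -/

section DimOne

variable {X : Scheme.{0}} [IsIntegral X]

/-- A point of an integral scheme other than the generic point is not maximal for the specialisation order
(the generic point is a proper generisation). [folklore] -/
theorem not_isMax_of_ne_genericPoint {x : X} (hx : x ≠ genericPoint X) : ¬ IsMax x := by
  intro h
  have h1 : x ≤ genericPoint X := Scheme.le_iff_specializes.mpr (genericPoint_specializes x)
  have h2 : x ⤳ genericPoint X := Scheme.le_iff_specializes.mp (h h1)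
  exact hx (h2.antisymm (genericPoint_specializes x)).eq

/-- **In a one-dimensional integral scheme a point other than the generic point has `height 0` and
`coheight 1`** (`height + coheight ≤ dim = 1`, and the generic point lies strictly above). [folklore] -/
theorem height_eq_zero_and_coheight_eq_one_of_ne_genericPoint
    (hX : topologicalKrullDim X ≤ ((1 : ℕ) : WithBot ℕ∞)) {x : X} (hx : x ≠ genericPoint X) :
    Order.height x = 0 ∧ Order.coheight x = 1 := by
  have hsum : Order.height x + Order.coheight x ≤ 1 := by
    have h := (coe_height_add_coheight_le_topologicalKrullDim x).trans hX
    exact_mod_cast h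
  have hco : (1 : ℕ∞) ≤ Order.coheight x :=
    Order.one_le_iff_ne_zero.mpr (Order.coheight_ne_zero.mpr (not_isMax_of_ne_genericPoint hx))
  have hh : Order.height x = 0 := by
    by_contra hne
    have h2 : (1 : ℕ∞) ≤ Order.height x := Order.one_le_iff_ne_zero.mpr hne
    have h3 : (2 : ℕ∞) ≤ Order.height x + Order.coheight x :=
      calc (2 : ℕ∞) = 1 + 1 := by norm_num
        _ ≤ Order.height x + Order.coheight x := add_le_add h2 hco
    have h4 : (2 : ℕ∞) ≤ 1 := h3.trans hsum
    exact absurd h4 (by norm_num)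
  refine ⟨hh, le_antisymm ?_ hco⟩
  rw [hh, zero_add] at hsum
  exact hsum

/-- **In a one-dimensional integral scheme every point other than the generic point is CLOSED** (it has
height `0`, i.e. no proper specialisation; schemes are `T₀`). [folklore] -/
theorem isClosed_singleton_of_ne_genericPoint
    (hX : topologicalKrullDim X ≤ ((1 : ℕ) : WithBot ℕ∞)) {x : X} (hx : x ≠ genericPoint X) :
    IsClosed ({x} : Set X) := by
  have hmin : IsMin x :=
    Order.height_eq_zero.mp (height_eq_zero_and_coheight_eq_one_of_ne_genericPoint hX hx).1
  rw [← closure_subset_iff_isClosed]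
  intro y hy
  have hxy : x ⤳ y := specializes_iff_mem_closure.mpr hy
  have hyx : y ⤳ x := Scheme.le_iff_specializes.mp (hmin (Scheme.le_iff_specializes.mpr hxy))
  exact (hyx.antisymm hxy).eq

/-- **In a one-dimensional integral scheme the local ring at a point other than the generic point has
dimension `1`** (`dim 𝒪_{X,x} = coheight x`, Stacks 02IZ). [cite: StacksProject, Tag 02IZ] -/
theorem ringKrullDim_stalk_eq_one_of_ne_genericPoint
    (hX : topologicalKrullDim X ≤ ((1 : ℕ) : WithBot ℕ∞)) {x : X} (hx : x ≠ genericPoint X) :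
    ringKrullDim (X.presheaf.stalk x) = ((1 : ℕ) : WithBot ℕ∞) := by
  rw [ringKrullDim_stalk_eq_coheight, (height_eq_zero_and_coheight_eq_one_of_ne_genericPoint hX hx).2]
  rfl

/-- A point of an integral scheme with non-regular local ring is not the generic point (whose local ring is
the function field). [folklore] -/
theorem ne_genericPoint_of_not_isRegularLocalRing {x : X} (hx : ¬ IsRegularLocalRing (X.presheaf.stalk x)) :
    x ≠ genericPoint X := by
  rintro rfl
  exact hx (inferInstanceAs (IsRegularLocalRing X.functionField))

end DimOne

/-! ## §3 The ambient local ring at a singular point of a curve on a smooth ambient -/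

section Ambient

variable {k : Type} [Field k]

/-- **The local rings of `V(X)` are the quotient stalks `𝒪_{Y,ι x}/X_{ι x}`.** [folklore] -/
theorem nonempty_quotient_stalkIdeal_equiv {Y : Scheme.{0}} (X : Y.IdealSheafData) (x : X.subscheme) :
    Nonempty ((Y.presheaf.stalk (X.subschemeι x) ⧸ stalkIdeal X (X.subschemeι x)) ≃+*
      X.subscheme.presheaf.stalk x) := by
  have hsurj : Function.Surjective (X.subschemeι.stalkMap x).hom := X.subschemeι.stalkMap_surjective x
  have hker : RingHom.ker (X.subschemeι.stalkMap x).hom = stalkIdeal X (X.subschemeι x) := by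
    rw [← stalkIdeal_ker_eq_ker_stalkMap X.subschemeι x, Scheme.IdealSheafData.ker_subschemeι]
  exact ⟨(Ideal.quotEquivOfEq hker.symm).trans (RingHom.quotientKerEquivOfSurjective hsurj)⟩

/-- **At a non-regular point of a CURVE hypersurface the ambient local ring is regular of dimension `2`.**
For a hypersurface pair `(Y, X)` with `dim V(X) = 1` and a point `x` of `V(X)` with `𝒪_{V(X),x}` not regular:
`𝒪_{Y,ι x}` is regular (smooth over a field) and `dim 𝒪_{Y,ι x} = dim 𝒪_{V(X),x} + 1 = 2` (the local equation
is a non-zero element of the maximal ideal of the domain `𝒪_{Y,ι x}`; Stacks 00KW). [folklore] -/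
theorem isRegularLocalRing_and_ringKrullDim_eq_two (P : HypersurfacePair k)
    (hP : topologicalKrullDim P.X.subscheme = ((1 : ℕ) : WithBot ℕ∞)) (x : P.X.subscheme)
    (hx : ¬ IsRegularLocalRing (P.X.subscheme.presheaf.stalk x)) :
    IsRegularLocalRing (P.Y.presheaf.stalk (P.X.subschemeι x)) ∧
      ringKrullDim (P.Y.presheaf.stalk (P.X.subschemeι x)) = ((2 : ℕ) : WithBot ℕ∞) := by
  haveI := P.isIntegral
  set η := P.X.subschemeι x with hη
  -- the ambient is regular
  haveI : IsLocallyNoetherian P.Y := LocallyOfFiniteType.isLocallyNoetherian P.f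
  have hY : Scheme.IsRegular P.Y := Scheme.IsRegular.of_smooth P.f (Scheme.isRegular_Spec (.of k))
  haveI hreg : IsRegularLocalRing (P.Y.presheaf.stalk η) := hY η
  haveI : IsDomain (P.Y.presheaf.stalk η) := isDomain_of_isRegularLocalRing _
  refine ⟨hreg, ?_⟩
  -- the hypersurface local ring has dimension `1`
  have hx1 : ringKrullDim (P.X.subscheme.presheaf.stalk x) = ((1 : ℕ) : WithBot ℕ∞) :=
    ringKrullDim_stalk_eq_one_of_ne_genericPoint hP.le (ne_genericPoint_of_not_isRegularLocalRing hx)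
  -- a local equation
  obtain ⟨g, hg⟩ := (P.isLocallyPrincipal η).isPrincipal_stalkIdeal
  replace hg : stalkIdeal P.X η = Ideal.span {g} := hg
  obtain ⟨e⟩ := nonempty_quotient_stalkIdeal_equiv P.X x
  rw [← hη, hg] at e
  -- it is non-zero (else `x` would be a regular point)
  have hg0 : g ≠ 0 := by
    rintro rfl
    have e0 : P.Y.presheaf.stalk η ≃+* P.X.subscheme.presheaf.stalk x :=
      ((RingEquiv.quotientBot _).symm.trans
        (Ideal.quotEquivOfEq (by rw [Ideal.span_singleton_eq_bot.mpr rfl] :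
          (⊥ : Ideal (P.Y.presheaf.stalk η)) = Ideal.span {(0 : P.Y.presheaf.stalk η)}))).trans e
    exact hx (IsRegularLocalRing.of_ringEquiv e0)
  -- and lies in the maximal ideal (`η ∈ Supp X`)
  have hgm : g ∈ maximalIdeal (P.Y.presheaf.stalk η) := by
    have hsupp : η ∈ P.X.support := by
      change η ∈ (P.X.support : Set P.Y)
      rw [← Scheme.IdealSheafData.range_subschemeι]
      exact ⟨x, rfl⟩
    have hle := (mem_support_iff_stalkIdeal_le P.X η).mp hsupp
    rw [hg] at hle
    exact hle (Ideal.mem_span_singleton_self g)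
  -- `dim 𝒪_{Y,η}/(g) + 1 = dim 𝒪_{Y,η}`
  have hdim := ringKrullDim_quotient_span_singleton_succ_eq_ringKrullDim_of_mem_nonZeroDivisors
    (mem_nonZeroDivisors_of_ne_zero hg0) hgm
  rw [ringKrullDim_eq_of_ringEquiv e, hx1] at hdim
  rw [← hdim]
  rfl

end Ambient

/-! ## §4 The stub -/

variable {k : Type} [Field k]

/-- **`stub_e1_base`** (M; registered stub of the E1 skeleton, signature verbatim). A hypersurface pair whose
hypersurface is a CURVE is a stage of rank `0` satisfying `Inv`: present `P.X` by its subscheme inclusion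
(`ker_subschemeι`), take `V = X`, `q = 𝟙`, the trivial atlas (`DatumToEmbedded.InitialAtlas.stub_initialAtlas`);
(I1): a maximal point of `Sing` of an integral curve is a closed point of `X`, where `dim 𝒪_Y = dim 𝒪_X + 1 = 2`
and `Y` is regular (smooth over a field); (I2): gradings by `Fin 0 → ℤ` have a single component, every ideal is
homogeneous, and the prime of a CLOSED point of an affine chart is maximal, so its quotient is a field. [folklore] -/
theorem stub_e1_base (P : HypersurfacePair k)
    (hP : topologicalKrullDim P.X.subscheme = ((1 : ℕ) : WithBot ℕ∞)) :
    ∃ S : Stage k, S.Inv ∧ S.j = 0 ∧ S.toPair = P := by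
  haveI := P.isIntegral
  -- the start stage: ambient `Y`, the hypersurface presented by its subscheme inclusion, `V = X`, `q = 𝟙`,
  -- torus rank `0` and the initial graded atlas
  obtain ⟨𝒜⟩ := DatumToEmbedded.InitialAtlas.stub_initialAtlas P.f P.X.subschemeι
  let S : Stage k :=
    { Y := P.Y, f := P.f, X := P.X.subscheme, i := P.X.subschemeι
      isLocallyPrincipal := by rw [Scheme.IdealSheafData.ker_subschemeι]; exact P.isLocallyPrincipal
      V := P.X.subscheme, q := 𝟙 _, g := P.X.subschemeι ≫ P.f, hq := Category.id_comp _, j := 0, atlas := 𝒜 }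
  -- maximal singular points are images of NON-REGULAR points of `V(X)`
  have hmax : ∀ {η : P.Y}, η ∈ S.maxSing →
      ∃ x : P.X.subscheme, ¬ IsRegularLocalRing (P.X.subscheme.presheaf.stalk x) ∧ P.X.subschemeι x = η := by
    intro η hη
    have h : η ∈ singImage (P.X.subschemeι).ker := hη.1
    rw [singImage_ker_eq_image_setOf_not_isRegularLocalRing] at h
    obtain ⟨x, hx, rfl⟩ := h
    exact ⟨x, hx, rfl⟩
  refine ⟨S, ⟨fun η hη => ?_, fun a η hηm hηW => ?_⟩, rfl, ?_⟩
  · -- (I1)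
    obtain ⟨x, hx, rfl⟩ := hmax hη
    exact isRegularLocalRing_and_ringKrullDim_eq_two P hP x hx
  · -- (I2)
    obtain ⟨x, hx, rfl⟩ := hmax hηm
    haveI : Subsingleton (Fin S.j → ℤ) := inferInstanceAs (Subsingleton (Fin 0 → ℤ))
    letI := S.atlas.gradedRing a
    refine ⟨isHomogeneous_of_subsingleton _ _, fun d s _ hs => ?_⟩
    -- `ι x` is a closed point of `Y`, so its prime on the affine chart is maximal
    have hxc : IsClosed ({x} : Set P.X.subscheme) :=
      isClosed_singleton_of_ne_genericPoint hP.le (ne_genericPoint_of_not_isRegularLocalRing hx)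
    have hηc : IsClosed ({P.X.subschemeι x} : Set P.Y) := by
      rw [← Set.image_singleton]
      exact P.X.subschemeι.isClosedEmbedding.isClosedMap _ hxc
    haveI hmax' := (S.atlas.W a).2.primeIdealOf_isMaximal_of_isClosed ⟨P.X.subschemeι x, hηW⟩ hηc
    letI := Ideal.Quotient.field (((S.atlas.W a).2.primeIdealOf ⟨P.X.subschemeι x, hηW⟩).asIdeal)
    exact isUnit_iff_ne_zero.mpr (mt Ideal.Quotient.eq_zero_iff_mem.mp hs)
  · -- the stage presents `P`
    obtain ⟨Y, f, X, hlp, hint⟩ := P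
    simp only [S, Stage.toPair, HypersurfacePair.ofKer]
    congr 1
    exact Scheme.IdealSheafData.ker_subschemeι X

end Summit.ResolutionOfSingularities.ResolutionOfSingularities.Theorems.ELadderOne

end
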